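import Mathlib.GroupTheory.Commutator.Basic
import Mathlib.GroupTheory.SpecificGroups.Cyclic
import Mathlib.Algebra.Group.Subgroup.Pointwise
import Mathlib.Algebra.BigOperators.Group.Finset.Basic
import Mathlib.GroupTheory.PGroup
import Mathlib.GroupTheory.GroupAction.Quotient
import HarnessLib

/-!
# The equivariant Iwasawa lemma, I: the group-theoretic step (Washington §13.3, Lemma 13.15, read
# through a conjugation-invariant functional)

Topic `NumberTheory/NumberFields` (namespace = path, grouping sub-namespace `EquivariantIwasawaLemma`).
THEOREM-ONLY file (no definition, no named fact, no `sorry`; pure group theory, no number fields yet),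
written by the literature seat `bsd-potss-conjA-anchor` g16 (cell `bsd-potss`; items
stmt-BirchSwinnertonDyer-19386 / 19413, `--supports … --as helper`; closes nothing).  It is the abstract
core of the EQUIVARIANT IWASAWA LEMMA of `EquivariantIwasawaLemma.lean`:

> for a cyclic extension `F/B` of number fields of prime degree `p` inside a Galois extension `F/k`
> with `Gal(F/B)` central in `Gal(F/k)`, a `p`-torsion `Gal(B/k)`-module `V` with (c2*)
> `Hom_{Gal(B/k)}(Cl(B), V) = 0` and (c3*) `V^{D_𝔭} = 0` for every prime `𝔭` of `B` ramified in `F`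
> (and one `Gal(B/k)`-orbit of ramified primes of size prime to `p`), one has `Hom_{Gal(F/k)}(Cl(F), V) = 0`

— the `V`-isotypic refinement of Iwasawa's «`p ∤ h_B`, one totally ramified prime `⟹ p ∤ h_F`»
(Washington Thm. 10.4, tree `ClassNumberPExtensionOnePrime.lean`), proved, like Washington's Lemma 13.15
(`X/(νY + ⟨σ_iσ_1⁻¹⟩) ≃ A(K)`), on the Galois group of the Hilbert class field and NOT through genus
theory (no unit index, no Herbrand quotient).

## The group-theoretic step (`eq_zero_of_ker_of_mem_commutator_sup`)

Abstracting `G = Gal(H_F/B)` (`H_F` the Hilbert class field of `F`), `r : G → Q = Gal(F/B)` (of prime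
order `p`) the restriction with kernel `A = Gal(H_F/F) ≅ Cl(F)`, `𝓘` the inertia groups of the primes of
`H_F` over `B` (each meets `A` trivially because `H_F/F` is unramified) and `φ : A → V` the functional
`f ∘ Artin⁻¹` to be killed: let `G` be a group, `r : G →* Q` a homomorphism to a group of prime order,
`φ : G → V` a function into an additive group which is ADDITIVE on `ker r` and INVARIANT under
`G`-conjugation on `ker r`, and `𝓘` a family of subgroups of `G` each meeting `ker r` trivially, such that
`φ (s t⁻¹) = 0` whenever `s ∈ I`, `t ∈ J` (`I, J ∈ 𝓘`) have the same image under `r`.  THEN `φ` VANISHES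
ON `ker r ⊓ (⁅G, G⁆ ⊔ ⨆_{I ∈ 𝓘} I)`.  Proof: `K = {x ∈ ker r : φ x = 0}` is a normal subgroup; every
commutator `⁅g, h⁆` lies in `K` (if `r h = 1`: `φ(g h g⁻¹ · h⁻¹) = φ h − φ h`; otherwise `r h` generates
`Q`, `g = h^m a` with `r a = 1` and `⁅g, h⁆ = h^m ⁅a, h⁆ h^{-m}`); if every `I ∈ 𝓘` is trivial we are done,
else pick `1 ≠ s₀ ∈ I₀ ∈ 𝓘`: every `s ∈ I ∈ 𝓘` has `r s = r (s₀^m)` for some `m`, so `s ∈ K·⟨s₀⟩`, whence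
`⁅G,G⁆ ⊔ ⨆ I ≤ K ⊔ ⟨s₀⟩ = K·⟨s₀⟩`, and an element `κ s₀^m` of the latter lying in `ker r` has
`s₀^m ∈ I₀ ⊓ ker r = 1`.  (Washington's `G' = (σ − 1)X` and `X ∩ ⟨G', I_1, …, I_s⟩ = G'·⟨σ_iσ_1⁻¹⟩` read
through the functional `φ`.)

WHAT IS PRINTED AND WHAT IS NOT.  Washington's Lemma 13.15 (with Lemma 13.14) is the statement
`G' = (σ−1)X`, `X ∩ (G'·⟨I_1,…,I_s⟩) = G'·⟨σ_2σ_1⁻¹, …, σ_sσ_1⁻¹⟩` for `G = X ⋊ ⟨σ⟩` with `X` abelian; the two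
public theorems below are exactly these two facts in the form «a functional `φ` on `X = ker r`, additive and
conjugation-invariant, that kills the differences `σ_iσ_j⁻¹` kills `X ∩ (G'·⟨I⟩)`» (no splitting `G = X ⋊ ⟨σ⟩`
is needed in this form, and `X` need not be a `p`-group).  The equivariant USE of them (the sibling file) is
not in print; the printed isotypic precedent is Gras's «θ-Chevalley formula» by genus theory (G. Gras, Bull.
SMF 106 (1978); Proc. Math. Sci. 127 (2017) §5) — a different road.  Private helpers are [folklore].

## References

* L. C. Washington, *Introduction to Cyclotomic Fields*, 2nd ed., GTM 83 (1997), §13.3 Lemmas 13.14–13.15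
  and Thm. 10.4 (proof). [Washington1997]
* S. V. Deo, A. Ray, R. Sujatha, *On the μ equals zero conjecture for fine Selmer groups in Iwasawa theory*,
  Pure Appl. Math. Q. 19 (2023), §3 (hypotheses (c1)–(c3) of Thm. 3.8/3.9, whose (c2) at the layers of the
  cyclotomic tower is what the equivariant lemma propagates). [DeoRaySujatha2023]
-/

namespace Literature.NumberTheory.NumberFields

namespace EquivariantIwasawaLemma

open scoped Pointwise commutatorElement

/-! ### Elementary helpers -/


/-- In a group of prime order every non-trivial element generates: `r g` is a power of `r h` as soon as
`r h ≠ 1`. [folklore] -/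
private theorem exists_zpow_eq_of_prime_card {Q : Type*} [Group Q] (hQ : (Nat.card Q).Prime)
    {q : Q} (hq : q ≠ 1) (x : Q) : ∃ m : ℤ, q ^ m = x := by
  haveI : Fact (Nat.card Q).Prime := ⟨hQ⟩
  have htop : Subgroup.zpowers q = ⊤ := zpowers_eq_top_of_prime_card rfl hq
  have hx : x ∈ Subgroup.zpowers q := by rw [htop]; exact Subgroup.mem_top x
  exact Subgroup.mem_zpowers_iff.mp hx

/-- A group of prime order is commutative. [folklore] -/
private theorem mul_comm_of_prime_card {Q : Type*} [Group Q] (hQ : (Nat.card Q).Prime) (x y : Q) :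
    x * y = y * x := by
  by_cases hx : x = 1
  · rw [hx, one_mul, mul_one]
  · obtain ⟨m, rfl⟩ := exists_zpow_eq_of_prime_card hQ hx y
    exact (Commute.self_zpow x m).eq

/-! ### The group-theoretic step -/

section GroupStep

variable {G Q V : Type*} [Group G] [Group Q] [AddCommGroup V]

/-- A function additive on `ker r` vanishes at `1`. [folklore] -/
private theorem map_one_eq_zero_of_add (r : G →* Q) (φ : G → V)
    (hadd : ∀ a b, r a = 1 → r b = 1 → φ (a * b) = φ a + φ b) : φ 1 = 0 := by
  have h := hadd 1 1 (map_one r) (map_one r)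
  rw [mul_one] at h
  exact left_eq_add.mp h

/-- A function additive on `ker r` is odd there: `φ a⁻¹ = - φ a`. [folklore] -/
private theorem map_inv_eq_neg_of_add (r : G →* Q) (φ : G → V)
    (hadd : ∀ a b, r a = 1 → r b = 1 → φ (a * b) = φ a + φ b) {a : G} (ha : r a = 1) :
    φ a⁻¹ = -φ a := by
  have h := hadd a a⁻¹ ha (by rw [map_inv, ha, inv_one])
  rw [mul_inv_cancel, map_one_eq_zero_of_add r φ hadd] at h
  exact (neg_eq_of_add_eq_zero_right h.symm).symm

/-- The commutator `⁅g, a⁆` with `a ∈ ker r` is killed by a `ker r`-additive, conjugation-invariant `φ`.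
[folklore] -/
private theorem map_commutatorElement_eq_zero_right (r : G →* Q) (φ : G → V)
    (hadd : ∀ a b, r a = 1 → r b = 1 → φ (a * b) = φ a + φ b)
    (hconj : ∀ g a, r a = 1 → φ (g * a * g⁻¹) = φ a) (g : G) {a : G} (ha : r a = 1) :
    φ ⁅g, a⁆ = 0 := by
  have h1 : r (g * a * g⁻¹) = 1 := by rw [map_mul, map_mul, ha, mul_one, map_inv, mul_inv_cancel]
  have h2 : r a⁻¹ = 1 := by rw [map_inv, ha, inv_one]
  rw [commutatorElement_def, hadd _ _ h1 h2, hconj g a ha, map_inv_eq_neg_of_add r φ hadd ha,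
    add_neg_cancel]

/-- Every commutator is killed by a `ker r`-additive, conjugation-invariant `φ` when the target of `r` has
prime order (Washington's `G' = (σ − 1)A` read through `φ`): if `r h ≠ 1` then `g = h^m a` with
`r a = 1` and `⁅g, h⁆ = h^m ⁅a, h⁆ h^{-m}`. [cite: Washington1997, §13.3 Lemma 13.15 (proof, `G' = (σ-1)X`)] -/
theorem map_commutatorElement_eq_zero (r : G →* Q) (hQ : (Nat.card Q).Prime) (φ : G → V)
    (hadd : ∀ a b, r a = 1 → r b = 1 → φ (a * b) = φ a + φ b)
    (hconj : ∀ g a, r a = 1 → φ (g * a * g⁻¹) = φ a) (g h : G) :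
    φ ⁅g, h⁆ = 0 := by
  by_cases hh : r h = 1
  · exact map_commutatorElement_eq_zero_right r φ hadd hconj g hh
  · -- `r h` generates `Q`: `r g = (r h)^m`, `a := (h^m)⁻¹ * g ∈ ker r`
    obtain ⟨m, hm⟩ := exists_zpow_eq_of_prime_card hQ hh (r g)
    set a : G := (h ^ m)⁻¹ * g with ha_def
    have ha : r a = 1 := by
      rw [ha_def, map_mul, map_inv, map_zpow, hm, inv_mul_cancel]
    have hg : g = h ^ m * a := by rw [ha_def, mul_inv_cancel_left]
    have hcomm : ⁅g, h⁆ = h ^ m * ⁅a, h⁆ * (h ^ m)⁻¹ := by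
      rw [hg, commutatorElement_def, commutatorElement_def]; group
    -- `⁅a, h⁆ ∈ ker r` and `φ ⁅a, h⁆ = - φ ⁅h, a⁆ = 0`
    have hah : r ⁅a, h⁆ = 1 := by
      rw [map_commutatorElement, ha, commutatorElement_one_left]
    have hφah : φ ⁅a, h⁆ = 0 := by
      rw [← commutatorElement_inv h a, map_inv_eq_neg_of_add r φ hadd
          (by rw [← commutatorElement_inv a h, map_inv, hah, inv_one]),
        map_commutatorElement_eq_zero_right r φ hadd hconj h ha, neg_zero]
    rw [hcomm, hconj _ _ hah, hφah]

/-- **The group-theoretic step of the equivariant Iwasawa lemma** (Washington's Lemma 13.15 through a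
functional).  `r : G →* Q` with `Q` of prime order; `φ : G → V` additive on `ker r` and invariant under
`G`-conjugation there; `𝓘` a family of subgroups of `G` meeting `ker r` trivially («inertia groups of an
unramified top layer»); and `φ (s t⁻¹) = 0` for all `s ∈ I`, `t ∈ J` (`I, J ∈ 𝓘`) with `r s = r t`
(«the differences of the canonical inertia generators are killed»).  Then `φ` vanishes on
`ker r ⊓ (⁅G, G⁆ ⊔ ⨆_{I ∈ 𝓘} I)` — in the application, on `Gal(H_F/F) ∩ Gal(H_F/P)` where `P/B` is the
maximal abelian subextension of `H_F/B` unramified over `B`.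
[cite: Washington1997, §13.3 Lemma 13.15 (`X ∩ ⟨G', I_1, …, I_s⟩`, finite level)] -/
theorem eq_zero_of_ker_of_mem_commutator_sup (r : G →* Q) (hQ : (Nat.card Q).Prime) (φ : G → V)
    (hadd : ∀ a b, r a = 1 → r b = 1 → φ (a * b) = φ a + φ b)
    (hconj : ∀ g a, r a = 1 → φ (g * a * g⁻¹) = φ a)
    (𝓘 : Set (Subgroup G)) (hI : ∀ I ∈ 𝓘, ∀ s ∈ I, r s = 1 → s = 1)
    (hdiff : ∀ I ∈ 𝓘, ∀ J ∈ 𝓘, ∀ s ∈ I, ∀ t ∈ J, r s = r t → φ (s * t⁻¹) = 0)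
    {x : G} (hxA : r x = 1) (hxN : x ∈ ⁅(⊤ : Subgroup G), ⊤⁆ ⊔ ⨆ I ∈ 𝓘, I) :
    φ x = 0 := by
  classical
  -- the normal subgroup `K = {x ∈ ker r : φ x = 0}`
  let K : Subgroup G :=
    { carrier := {x | r x = 1 ∧ φ x = 0}
      one_mem' := ⟨map_one r, map_one_eq_zero_of_add r φ hadd⟩
      mul_mem' := fun {a b} ha hb => ⟨by rw [map_mul, ha.1, hb.1, one_mul],
        by rw [hadd a b ha.1 hb.1, ha.2, hb.2, add_zero]⟩
      inv_mem' := fun {a} ha => ⟨by rw [map_inv, ha.1, inv_one],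
        by rw [map_inv_eq_neg_of_add r φ hadd ha.1, ha.2, neg_zero]⟩ }
  have hmemK : ∀ y, y ∈ K ↔ r y = 1 ∧ φ y = 0 := fun y => Iff.rfl
  haveI hKn : K.Normal := ⟨fun y hy g => by
    rw [hmemK] at hy ⊢
    exact ⟨by rw [map_mul, map_mul, hy.1, mul_one, map_inv, mul_inv_cancel], by rw [hconj g y hy.1, hy.2]⟩⟩
  -- commutators lie in `K`
  have hcommK : ⁅(⊤ : Subgroup G), ⊤⁆ ≤ K := by
    rw [Subgroup.commutator_le]
    intro g _ h _
    rw [hmemK]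
    refine ⟨?_, map_commutatorElement_eq_zero r hQ φ hadd hconj g h⟩
    rw [map_commutatorElement, commutatorElement_eq_one_iff_mul_comm]
    exact mul_comm_of_prime_card hQ (r g) (r h)
  suffices hx : x ∈ K from ((hmemK x).mp hx).2
  by_cases hex : ∃ I ∈ 𝓘, ∃ s ∈ I, s ≠ 1
  · obtain ⟨I₀, hI₀, s₀, hs₀, hs₀1⟩ := hex
    have hq₀ : r s₀ ≠ 1 := fun h => hs₀1 (hI I₀ hI₀ s₀ hs₀ h)
    -- `⁅G,G⁆ ⊔ ⨆ I ≤ K ⊔ ⟨s₀⟩`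
    have hle : ⁅(⊤ : Subgroup G), ⊤⁆ ⊔ ⨆ I ∈ 𝓘, I ≤ K ⊔ Subgroup.zpowers s₀ := by
      refine sup_le (hcommK.trans le_sup_left) (iSup₂_le fun I hI' s hs => ?_)
      obtain ⟨m, hm⟩ := exists_zpow_eq_of_prime_card hQ hq₀ (r s)
      have hst : s * (s₀ ^ m)⁻¹ ∈ K := by
        rw [hmemK]
        refine ⟨by rw [map_mul, map_inv, map_zpow, hm, mul_inv_cancel], ?_⟩
        exact hdiff I hI' I₀ hI₀ s hs (s₀ ^ m) (Subgroup.zpow_mem I₀ hs₀ m) (by rw [map_zpow, hm])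
      have : s = s * (s₀ ^ m)⁻¹ * s₀ ^ m := by rw [inv_mul_cancel_right]
      rw [this]
      exact Subgroup.mul_mem _ (Subgroup.mem_sup_left hst)
        (Subgroup.mem_sup_right (Subgroup.zpow_mem _ (Subgroup.mem_zpowers s₀) m))
    -- an element of `K·⟨s₀⟩` lying in `ker r` lies in `K`
    have hx' : x ∈ K ⊔ Subgroup.zpowers s₀ := hle hxN
    have hx'' : x ∈ ((K : Set G) * (Subgroup.zpowers s₀ : Set G)) := by
      rw [← Subgroup.normal_mul]; exact hx'
    obtain ⟨κ, hκ, y, hy, rfl⟩ := Set.mem_mul.mp hx''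
    obtain ⟨m, rfl⟩ := Subgroup.mem_zpowers_iff.mp hy
    have hry : r (s₀ ^ m) = 1 := by
      have h := hxA
      rw [map_mul, ((hmemK κ).mp hκ).1, one_mul] at h
      exact h
    have hy1 : s₀ ^ m = 1 := hI I₀ hI₀ _ (Subgroup.zpow_mem I₀ hs₀ m) hry
    rw [hy1, mul_one]
    exact hκ
  · -- every `I ∈ 𝓘` is trivial
    push Not at hex
    have hbot : ⨆ I ∈ 𝓘, I = (⊥ : Subgroup G) := by
      refine le_antisymm (iSup₂_le fun I hI' s hs => ?_) bot_le
      rw [hex I hI' s hs]; exact Subgroup.one_mem _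
    rw [hbot, sup_bot_eq] at hxN
    exact hcommK hxN

end GroupStep


end EquivariantIwasawaLemma

end Literature.NumberTheory.NumberFields
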